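import Literature.NumberTheory.Automorphic.ShellTwistGL2Local
import Literature.NumberTheory.Automorphic.OpenSubgroupCosetIntegral
import Literature.NumberTheory.Automorphic.TestFunctionDerivLinear
import Literature.NumberTheory.Automorphic.SmoothedVectorTranslation
import Literature.NumberTheory.Automorphic.AutomorphicRepsGLCuspidalL2Step1KFinite
import HarnessLib

/-!
# Shell smoothing of weights at a finite place: finite coset sums, level, and the twisted projector

Topic `NumberTheory/Automorphic`; namespace `Literature.NumberTheory.Automorphic`. Groundwork for the
finite-place half of the Kirillov `L²`-bound of the smoothed Whittaker coefficient on `GL_2` (the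
`n ≤ 2` case of the named fact `JacquetShalika1981_partialPairL_pole_of_eq_conj`), weight layer.

Fix a finite place `v` of `K`, a shell subgroup `J = J_{r,c} ≤ GL_2(K_v)` with its character
`χ_v(j) = ψ_v(j₁₂)` (`ShellSubgroupGL2`, `ShellTwistGL2Local`) and a level `N` with
`K_v(e^{-N}) ≤ J ∩ ker χ_v` (`ShellDatum`: the inequalities `-N ≤ r`, `c + r ≤ N`, `c ≤ N`,
`c - r ≤ N` and `ψ_v|_{𝔭^{c-r}} = 1`). The quotient `J / K_v(e^{-N})` is finite; write `m_q` for the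
Haar masses of its cosets and `j_q` for representatives. The **shell convolution** of a real weight
`θ` on `GL_2(𝔸_K)` is the complex weight

  `(e_J ⋆ θ)(h) = ∑_q m_q χ̄_v(j_q) θ(ι_v(j_q)⁻¹ h)`   (`ShellDatum.shellConv`; real and imaginary parts
  `shellRe`, `shellIm`),

a finite combination of left translates of `θ`. We PROVE: for `θ` left `ι_v(K_v(e^{-N}))`-invariant it
is the honest twisted average `∫_J χ̄_v(j) θ(ι_v(j)⁻¹ h) dj` (`shellConv_eq_integral`, via
`OpenSubgroupCosetIntegral`), hence `χ̄_v`-equivariant under left translation by `ι_v(J)`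
(`shellConv_toAdelic_mul`); its real and imaginary parts are test functions (`isTestFunctionGL_shellRe/Im`),
left invariant under `(1, U ⊓ K_v(e^{-N}))` when `θ` is left `(1,U)`-invariant and `U ⊇ ι_v^∞(K_v(e^{-N}))`
(`shellRe_ofFinite_mul`), their archimedean word derivatives are the shell convolutions of those of `θ`
(`wordDerivWeight_shellRe`), and on smoothed vectors
`S_{Re(e_J⋆θ)} f + i S_{Im(e_J⋆θ)} f = E (S_θ f)` with `E` the twisted average of
`TwistedSubgroupAverage` for `(J, R ∘ ι_v, χ_v)` (`coe_smoothedVector_shellRe_add_shellIm`). All proofs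
complete; the only definitions are the honest data bundle `ShellDatum` and the explicit finite sums
(Bump (1997), §3.1, §4.4: the idempotents of the Hecke algebra of locally constant functions).

## References

* D. Bump, *Automorphic Forms and Representations*, CUP (1997), §3.1, §4.4 [Bump1997].
* H. Jacquet, J. A. Shalika, *On Euler products and the classification of automorphic
  representations I*, Amer. J. Math. 103 (1981), §4–§5 [JacquetShalikaAJM1981].
-/

noncomputable section

open scoped MatrixGroups ComplexConjugate Classical
open Matrix WithZero NumberField IsDedekindDomain MeasureTheory Topology

namespace Literature.NumberTheory.Automorphic

open ShellGL2

variable (K : Type) [Field K] [NumberField K] (v : HeightOneSpectrum (𝓞 K))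

local notation "𝓋" => (Valued.v : Valuation (v.adicCompletion K) (WithZero (Multiplicative ℤ)))

/-- **Shell datum at `v`**: exponents `r`, `c ≥ 1` of a shell subgroup `J_{r,c} ≤ GL_2(K_v)` and a
level `N` with `K_v(e^{-N}) ≤ J_{r,c} ∩ ker χ_v`, for `ψ_v` trivial on `𝔭_v^{c-r}`. [cite: Bump1997, §4.4] -/
structure ShellDatum where
  /-- the exponent of the upper-right entries (`𝔭^{-r}`) -/
  r : ℤ
  /-- the congruence exponent of the diagonal entries (`1 + 𝔭^{c}`) -/
  c : ℤ
  hc : 1 ≤ c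
  /-- the level -/
  N : ℕ
  hN1 : -(N : ℤ) ≤ r
  hN2 : c + r ≤ N
  hN3 : c ≤ N
  hN4 : c - r ≤ N
  hψ : ∀ x : v.adicCompletion K, Valued.v x ≤ exp (r - c) → (adeleAddChar K).adicComponent v x = 1

namespace ShellDatum

variable {K v} (D : ShellDatum K v)

/-- The shell subgroup `J`. [folklore] -/
def J : Subgroup (GL (Fin 2) (v.adicCompletion K)) := shellSubgroup D.r D.c D.hc

/-- Auxiliary. [folklore] -/
theorem mem_J_iff {g : GL (Fin 2) (v.adicCompletion K)} : g ∈ D.J ↔ ShellCond D.r D.c g := Iff.rfl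

/-- Auxiliary. [folklore] -/
theorem isCompact_J : IsCompact (D.J : Set (GL (Fin 2) (v.adicCompletion K))) := isCompact_shellSubgroup K v D.hc

/-- **Admissible levels**: `N'` with `K_v(e^{-N'}) ≤ J ∩ ker χ_v`, i.e. `-N' ≤ r`, `c + r ≤ N'`, `c ≤ N'`,
`c - r ≤ N'` (the level `D.N` of the datum is one). [folklore] -/
def LevelOK (N' : ℕ) : Prop := -(N' : ℤ) ≤ D.r ∧ D.c + D.r ≤ N' ∧ D.c ≤ N' ∧ D.c - D.r ≤ N'

/-- Auxiliary. [folklore] -/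
theorem levelOK_N : D.LevelOK D.N := ⟨D.hN1, D.hN2, D.hN3, D.hN4⟩

/-- Auxiliary. [folklore] -/
theorem LevelOK.mono {N' N'' : ℕ} (h : D.LevelOK N') (hle : N' ≤ N'') : D.LevelOK N'' := by
  obtain ⟨h1, h2, h3, h4⟩ := h
  refine ⟨?_, ?_, ?_, ?_⟩ <;> omega

/-- `K_v(e^{-N'}) ≤ J` for an admissible level. [folklore] -/
theorem localCongruenceSubgroup_le_J {N' : ℕ} (h : D.LevelOK N') : localCongruenceSubgroup 2 K v N' ≤ D.J :=
  localCongruenceSubgroup_le_shellSubgroup K v D.hc h.1 h.2.1 h.2.2.1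

/-- `χ_v = 1` on `K_v(e^{-N'})` for an admissible level. [folklore] -/
theorem shellChar_eq_one_of_mem_localCongruenceSubgroup {N' : ℕ} (hN' : D.LevelOK N') {k : GL (Fin 2) (v.adicCompletion K)}
    (hk : k ∈ localCongruenceSubgroup 2 K v N') : shellChar K v k = 1 := by
  rw [shellChar_apply]
  obtain ⟨-, -, h⟩ := hk
  have h01 := h 0 1
  rw [Matrix.sub_apply, Matrix.one_apply_ne (by decide), sub_zero] at h01
  have hle : Valued.v (ent k 0 1) ≤ exp (D.r - D.c) := h01.trans (exp_le_exp.2 (show -(N' : ℤ) ≤ D.r - D.c by have := hN'.2.2.2; omega))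
  rw [D.hψ _ hle, Circle.coe_one]

/-- The level subgroup `K_v(e^{-N})` of the datum (the discretisation level). [folklore] -/
def Kv : Subgroup (GL (Fin 2) (v.adicCompletion K)) := localCongruenceSubgroup 2 K v D.N

/-- Auxiliary. [folklore] -/
theorem Kv_le_J : D.Kv ≤ D.J := D.localCongruenceSubgroup_le_J D.levelOK_N

/-- Auxiliary. [folklore] -/
theorem isOpen_Kv : IsOpen (D.Kv : Set (GL (Fin 2) (v.adicCompletion K))) := isOpen_localCongruenceSubgroup 2 K v D.N

/-- `χ_v = 1` on `K_v(e^{-N})`. [folklore] -/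
theorem shellChar_eq_one_of_mem_Kv {k : GL (Fin 2) (v.adicCompletion K)} (hk : k ∈ D.Kv) : shellChar K v k = 1 :=
  D.shellChar_eq_one_of_mem_localCongruenceSubgroup D.levelOK_N hk

/-- `K_v(e^{-N})` as an (open) subgroup of `J`. [folklore] -/
def KJ : Subgroup ↥D.J := D.Kv.subgroupOf D.J

/-- Auxiliary. [folklore] -/
theorem mem_KJ_iff {k : ↥D.J} : k ∈ D.KJ ↔ (k : GL (Fin 2) (v.adicCompletion K)) ∈ D.Kv := Subgroup.mem_subgroupOf

/-- Auxiliary. [folklore] -/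
theorem isOpen_KJ : IsOpen (D.KJ : Set ↥D.J) := D.isOpen_Kv.preimage continuous_subtype_val

/-- `J` is a compact space. -/
instance compactSpace_J : CompactSpace ↥D.J := compactSpace_subgroup D.J D.isCompact_J

/-- `J / K_v(e^{-N})` is finite. -/
instance finite_quotient : Finite (↥D.J ⧸ D.KJ) := Subgroup.quotient_finite_of_isOpen D.KJ D.isOpen_KJ

/-- The finite set of shells `J / K_v(e^{-N})`. -/
instance fintype_quotient : Fintype (↥D.J ⧸ D.KJ) := Fintype.ofFinite _

section Haar

variable [MeasurableSpace (GL (Fin 2) (v.adicCompletion K))] [BorelSpace (GL (Fin 2) (v.adicCompletion K))]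

/-- The Haar mass of the shell `q`. [folklore] -/
def mass (q : ↥D.J ⧸ D.KJ) : ℝ := ((subgroupHaar D.J D.isCompact_J) ((QuotientGroup.mk : ↥D.J → ↥D.J ⧸ D.KJ) ⁻¹' {q})).toReal

/-- Auxiliary. [folklore] -/
theorem mass_nonneg (q : ↥D.J ⧸ D.KJ) : 0 ≤ D.mass q := ENNReal.toReal_nonneg

/-- The masses add up to `1`. [folklore] -/
theorem sum_mass : ∑ q, D.mass q = 1 := by
  have h := sum_measureReal_preimage_mk (subgroupHaar D.J D.isCompact_J) D.KJ D.isOpen_KJ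
  rw [measure_univ, ENNReal.toReal_one] at h
  exact h

end Haar

/-- A representative of the shell `q`. [folklore] -/
def rep (q : ↥D.J ⧸ D.KJ) : GL (Fin 2) (v.adicCompletion K) := ((q.out : ↥D.J) : GL (Fin 2) (v.adicCompletion K))

/-- Auxiliary. [folklore] -/
theorem rep_mem (q : ↥D.J ⧸ D.KJ) : ShellCond D.r D.c (D.rep q) := (q.out : ↥D.J).2

section Conv

variable [MeasurableSpace (GL (Fin 2) (v.adicCompletion K))] [BorelSpace (GL (Fin 2) (v.adicCompletion K))]

/-- The coefficient `m_q χ̄_v(j_q)` of the shell `q`. [folklore] -/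
def coef (q : ↥D.J ⧸ D.KJ) : ℂ := (D.mass q : ℂ) * conj (shellChar K v (D.rep q))

/-- **The shell convolution** `(e_J ⋆ θ)(h) = ∑_q m_q χ̄_v(j_q) θ(ι_v(j_q)⁻¹ h)`. [cite: Bump1997, §4.4] -/
def shellConv (θ : (AdelicGroupData.gl 2 K).Adelic → ℝ) (h : (AdelicGroupData.gl 2 K).Adelic) : ℂ :=
  ∑ q, D.coef q * θ ((GLn.toAdelic 2 K v (D.rep q))⁻¹ * h)

/-- Its real part. [folklore] -/
def shellRe (θ : (AdelicGroupData.gl 2 K).Adelic → ℝ) (h : (AdelicGroupData.gl 2 K).Adelic) : ℝ := (D.shellConv θ h).re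

/-- Its imaginary part. [folklore] -/
def shellIm (θ : (AdelicGroupData.gl 2 K).Adelic → ℝ) (h : (AdelicGroupData.gl 2 K).Adelic) : ℝ := (D.shellConv θ h).im

/-- Auxiliary. [folklore] -/
theorem shellConv_apply (θ : (AdelicGroupData.gl 2 K).Adelic → ℝ) (h : (AdelicGroupData.gl 2 K).Adelic) :
    D.shellConv θ h = ∑ q, D.coef q * θ ((GLn.toAdelic 2 K v (D.rep q))⁻¹ * h) := rfl

/-- `Re(e_J ⋆ θ) = ∑_q Re(c_q) · L_{ι_v(j_q)} θ`. [folklore] -/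
theorem shellRe_eq_sum (θ : (AdelicGroupData.gl 2 K).Adelic → ℝ) :
    D.shellRe θ = ∑ q, (D.coef q).re • leftTranslateWeight (n := 2) (GLn.toAdelic 2 K v (D.rep q)) θ := by
  funext h
  simp only [shellRe, shellConv_apply, Complex.re_sum, Finset.sum_apply, Pi.smul_apply, leftTranslateWeight_apply, smul_eq_mul,
    Complex.mul_re, Complex.ofReal_re, Complex.ofReal_im, mul_zero, sub_zero]

/-- `Im(e_J ⋆ θ) = ∑_q Im(c_q) · L_{ι_v(j_q)} θ`. [folklore] -/
theorem shellIm_eq_sum (θ : (AdelicGroupData.gl 2 K).Adelic → ℝ) :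
    D.shellIm θ = ∑ q, (D.coef q).im • leftTranslateWeight (n := 2) (GLn.toAdelic 2 K v (D.rep q)) θ := by
  funext h
  simp only [shellIm, shellConv_apply, Complex.im_sum, Finset.sum_apply, Pi.smul_apply, leftTranslateWeight_apply, smul_eq_mul,
    Complex.mul_im, Complex.ofReal_re, Complex.ofReal_im, mul_zero, zero_add]

/-- `Re + i Im`. [folklore] -/
theorem shellRe_add_shellIm (θ : (AdelicGroupData.gl 2 K).Adelic → ℝ) (h : (AdelicGroupData.gl 2 K).Adelic) :
    (D.shellRe θ h : ℂ) + Complex.I * D.shellIm θ h = D.shellConv θ h := by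
  rw [shellRe, shellIm, mul_comm]; exact Complex.re_add_im _

end Conv

/-! ### Test functions -/

/-- The zero weight is a test function. [folklore] -/
theorem _root_.Literature.NumberTheory.Automorphic.isTestFunctionGL_zero (n : ℕ) (K : Type) [Field K] [NumberField K] :
    IsTestFunctionGL n K (0 : (AdelicGroupData.gl n K).Adelic → ℝ) := by
  refine ⟨continuous_const, ?_, ?_, ⟨_, principalCongruenceLevel_mem_finiteLevelsGL_holds n K one_ne_zero, fun _ _ _ => rfl⟩⟩
  · exact HasCompactSupport.of_support_subset_isCompact isCompact_empty (fun x hx => hx rfl)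
  · have e : (fun g : (AdelicGroupData.gl n K).Adelic => (((0 : (AdelicGroupData.gl n K).Adelic → ℝ) g : ℝ) : ℂ)) = 0 := by
      funext g; simp
    have h0 : IsArchSmooth (AutomorphyDatum.gl n K (isCompact_glFiniteIntegralLevel_holds n K)).ofArch (0 : (AdelicGroupData.gl n K).Adelic → ℂ) :=
      (archSmooth _).zero_mem
    rw [← e] at h0
    exact h0

/-- Finite sums of test functions are test functions. [folklore] -/
theorem _root_.Literature.NumberTheory.Automorphic.isTestFunctionGL_finset_sum {n : ℕ} {K : Type} [Field K] [NumberField K]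
    {ι' : Type*} (s : Finset ι') {θ : ι' → (AdelicGroupData.gl n K).Adelic → ℝ} (hθ : ∀ i ∈ s, IsTestFunctionGL n K (θ i)) :
    IsTestFunctionGL n K (∑ i ∈ s, θ i) := by
  classical
  induction s using Finset.induction_on with
  | empty => rw [Finset.sum_empty]; exact isTestFunctionGL_zero n K
  | insert i s hi ih =>
    rw [Finset.sum_insert hi]
    exact (hθ i (Finset.mem_insert_self i s)).add (ih fun j hj => hθ j (Finset.mem_insert_of_mem hj))

section TestFun

variable [MeasurableSpace (GL (Fin 2) (v.adicCompletion K))] [BorelSpace (GL (Fin 2) (v.adicCompletion K))]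

/-- **`Re(e_J ⋆ θ)` is a test function** for a test function `θ`. [folklore] -/
theorem isTestFunctionGL_shellRe {θ : (AdelicGroupData.gl 2 K).Adelic → ℝ} (hθ : IsTestFunctionGL 2 K θ) : IsTestFunctionGL 2 K (D.shellRe θ) := by
  rw [shellRe_eq_sum]
  exact isTestFunctionGL_finset_sum _ fun q _ => (hθ.leftTranslate _).const_smul _

/-- **`Im(e_J ⋆ θ)` is a test function** for a test function `θ`. [folklore] -/
theorem isTestFunctionGL_shellIm {θ : (AdelicGroupData.gl 2 K).Adelic → ℝ} (hθ : IsTestFunctionGL 2 K θ) : IsTestFunctionGL 2 K (D.shellIm θ) := by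
  rw [shellIm_eq_sum]
  exact isTestFunctionGL_finset_sum _ fun q _ => (hθ.leftTranslate _).const_smul _

end TestFun

/-! ### The integral form and left equivariance -/

section Integral

variable [MeasurableSpace (GL (Fin 2) (v.adicCompletion K))] [BorelSpace (GL (Fin 2) (v.adicCompletion K))]

/-- `θ` is left invariant under `ι_v(K_v(e^{-N}))`. [folklore] -/
def IsLeftKvInvariant (θ : (AdelicGroupData.gl 2 K).Adelic → ℝ) : Prop :=
  ∀ k ∈ D.Kv, ∀ h : (AdelicGroupData.gl 2 K).Adelic, θ (GLn.toAdelic 2 K v k * h) = θ h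

omit [MeasurableSpace (GL (Fin 2) (v.adicCompletion K))] [BorelSpace (GL (Fin 2) (v.adicCompletion K))] in
/-- Auxiliary. [folklore] -/
theorem continuous_shell_integrand {θ : (AdelicGroupData.gl 2 K).Adelic → ℝ} (hθc : Continuous θ) (h : (AdelicGroupData.gl 2 K).Adelic) :
    Continuous fun j : ↥D.J => conj (shellChar K v (j : GL (Fin 2) (v.adicCompletion K))) *
      (θ ((GLn.toAdelic 2 K v (j : GL (Fin 2) (v.adicCompletion K)))⁻¹ * h) : ℂ) :=
  ((Complex.continuous_conj.comp ((continuous_shellChar K v).comp continuous_subtype_val))).mul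
    (Complex.continuous_ofReal.comp (hθc.comp ((((GLn.continuous_toAdelic 2 K v).comp continuous_subtype_val).inv).mul continuous_const)))

/-- **The shell convolution is the twisted average** `∫_J χ̄_v(j) θ(ι_v(j)⁻¹ h) dj` for `θ` continuous and
left `ι_v(K_v(e^{-N}))`-invariant (the integrand is right `K_v(e^{-N})`-invariant on `J`). [cite: Bump1997, §4.4] -/
theorem shellConv_eq_integral {θ : (AdelicGroupData.gl 2 K).Adelic → ℝ} (hθc : Continuous θ) (hθK : D.IsLeftKvInvariant θ)
    (h : (AdelicGroupData.gl 2 K).Adelic) :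
    D.shellConv θ h = ∫ j : ↥D.J, conj (shellChar K v (j : GL (Fin 2) (v.adicCompletion K))) *
      (θ ((GLn.toAdelic 2 K v (j : GL (Fin 2) (v.adicCompletion K)))⁻¹ * h) : ℂ) ∂(subgroupHaar D.J D.isCompact_J) := by
  have hFi : Integrable (fun j : ↥D.J => conj (shellChar K v (j : GL (Fin 2) (v.adicCompletion K))) *
      (θ ((GLn.toAdelic 2 K v (j : GL (Fin 2) (v.adicCompletion K)))⁻¹ * h) : ℂ)) (subgroupHaar D.J D.isCompact_J) :=
    (D.continuous_shell_integrand hθc h).integrable_of_hasCompactSupport (HasCompactSupport.of_compactSpace _)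
  have hF : ∀ j : ↥D.J, ∀ k ∈ D.KJ, conj (shellChar K v ((j * k : ↥D.J) : GL (Fin 2) (v.adicCompletion K))) *
      (θ ((GLn.toAdelic 2 K v ((j * k : ↥D.J) : GL (Fin 2) (v.adicCompletion K)))⁻¹ * h) : ℂ) =
      conj (shellChar K v (j : GL (Fin 2) (v.adicCompletion K))) * (θ ((GLn.toAdelic 2 K v (j : GL (Fin 2) (v.adicCompletion K)))⁻¹ * h) : ℂ) := by
    intro j k hk
    have hk' : (k : GL (Fin 2) (v.adicCompletion K)) ∈ D.Kv := D.mem_KJ_iff.1 hk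
    rw [Subgroup.coe_mul, shellChar_mul D.hψ j.2 (D.Kv_le_J hk'), D.shellChar_eq_one_of_mem_Kv hk', mul_one, map_mul, _root_.mul_inv_rev,
      ← map_inv, mul_assoc, hθK _ (D.Kv.inv_mem hk')]
  rw [integral_eq_sum_quotient_of_mul_invariant (subgroupHaar D.J D.isCompact_J) D.KJ D.isOpen_KJ hFi hF, shellConv_apply]
  refine Finset.sum_congr rfl fun q _ => ?_
  rw [coef, rep, mass, Complex.real_smul, mul_assoc]

/-- **Left `χ̄_v`-equivariance under `ι_v(J)`**: `(e_J ⋆ θ)(ι_v(j₀) h) = χ̄_v(j₀) (e_J ⋆ θ)(h)`. [cite: Bump1997, §4.4] -/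
theorem shellConv_toAdelic_mul {θ : (AdelicGroupData.gl 2 K).Adelic → ℝ} (hθc : Continuous θ) (hθK : D.IsLeftKvInvariant θ)
    {j₀ : GL (Fin 2) (v.adicCompletion K)} (hj₀ : ShellCond D.r D.c j₀) (h : (AdelicGroupData.gl 2 K).Adelic) :
    D.shellConv θ (GLn.toAdelic 2 K v j₀ * h) = conj (shellChar K v j₀) * D.shellConv θ h := by
  rw [D.shellConv_eq_integral hθc hθK, D.shellConv_eq_integral hθc hθK, ← integral_const_mul]
  rw [← integral_mul_left_eq_self (μ := subgroupHaar D.J D.isCompact_J) _ (⟨j₀, hj₀⟩ : ↥D.J)]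
  refine integral_congr_ae (ae_of_all _ fun j => ?_)
  simp only [Subgroup.coe_mul]
  rw [shellChar_mul D.hψ hj₀ j.2, map_mul, map_mul, _root_.mul_inv_rev, mul_assoc ((GLn.toAdelic 2 K v (j : GL (Fin 2) (v.adicCompletion K)))⁻¹),
    inv_mul_cancel_left, mul_assoc]

/-- Left invariance under elements trivial at `v` which leave `θ` invariant. [folklore] -/
theorem shellConv_mul_of_toLocalAt_eq_one (θ : (AdelicGroupData.gl 2 K).Adelic → ℝ) {s : (AdelicGroupData.gl 2 K).Adelic}
    (hs : GLn.toLocalAt 2 K v s = 1) (hθs : ∀ h, θ (s * h) = θ h) (h : (AdelicGroupData.gl 2 K).Adelic) :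
    D.shellConv θ (s * h) = D.shellConv θ h := by
  simp only [shellConv_apply]
  refine Finset.sum_congr rfl fun q _ => ?_
  rw [← map_inv, ← mul_assoc, GLn.toAdelic_mul_eq_mul_toAdelic hs, mul_assoc, hθs]

/-! ### The level of the shell convolution -/

variable {U : Subgroup (GL (Fin 2) (FiniteAdeleRing (𝓞 K) K))}

omit [MeasurableSpace (GL (Fin 2) (v.adicCompletion K))] [BorelSpace (GL (Fin 2) (v.adicCompletion K))] in
/-- A left `(1,U)`-invariant weight is left `ι_v(K_v(e^{-N}))`-invariant when `U ⊇ ι_v^∞(K_v(e^{-N}))`. [folklore] -/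
theorem isLeftKvInvariant_of_level (hKU : (D.Kv).map (ofLocalFinite K v) ≤ U) {θ : (AdelicGroupData.gl 2 K).Adelic → ℝ}
    (hθU : ∀ u ∈ U, ∀ g : GL (Fin 2) (AdeleRing (𝓞 K) K), θ (GLn.ofFinite 2 K u * g) = θ g) :
    D.IsLeftKvInvariant θ := by
  intro k hk h
  have hmem : ofLocalFinite K v k ∈ U := hKU ⟨k, hk, rfl⟩
  have e : GLn.toAdelic 2 K v k = (GLn.ofFinite 2 K (ofLocalFinite K v k) : (AdelicGroupData.gl 2 K).Adelic) := (ofFinite_ofLocalFinite K v k).symm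
  rw [e]
  exact hθU _ hmem h

/-- **The level of the shell convolution.** Let `N'` be an admissible level with
`U ⊇ ι_v^∞(K_v(e^{-N'}))`, and let `θ` be left `ι_v(K_v(e^{-N}))`-invariant and left invariant under the
elements of `(1,U)` trivial at `v`. Then `e_J ⋆ θ` is left `(1, U ⊓ K_v(e^{-N'}))`-invariant. (Typical `θ`:
`L_{ι_v(a)} θ'` for `θ'` left `(1,U)`-invariant and `a ∈ GL_2(K_v)`.) [cite: Bump1997, §4.4] -/
theorem shellConv_ofFinite_mul {N' : ℕ} (hN' : D.LevelOK N') (hKU : (localCongruenceSubgroup 2 K v N').map (ofLocalFinite K v) ≤ U)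
    {θ : (AdelicGroupData.gl 2 K).Adelic → ℝ} (hθc : Continuous θ) (hθK : D.IsLeftKvInvariant θ)
    (hθU : ∀ u ∈ U, GLn.toLocalAt 2 K v (GLn.ofFinite 2 K u) = 1 → ∀ g : GL (Fin 2) (AdeleRing (𝓞 K) K), θ (GLn.ofFinite 2 K u * g) = θ g)
    {u : GL (Fin 2) (FiniteAdeleRing (𝓞 K) K)} (hu : u ∈ levelInfAt K v U N') (g : GL (Fin 2) (AdeleRing (𝓞 K) K)) :
    D.shellConv θ (GLn.ofFinite 2 K u * g) = D.shellConv θ g := by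
  have huv : toLocalFinite K v u ∈ localCongruenceSubgroup 2 K v N' := hu.2
  set s : (AdelicGroupData.gl 2 K).Adelic := GLn.awayFrom 2 K v (GLn.ofFinite 2 K u) with hs
  have hs1 : GLn.toLocalAt 2 K v s = 1 := GLn.toLocal_awayFrom _
  have hθs : ∀ h, θ (s * h) = θ h := by
    intro h
    have e : s = (GLn.ofFinite 2 K (u * (ofLocalFinite K v (toLocalFinite K v u))⁻¹) : (AdelicGroupData.gl 2 K).Adelic) := by
      rw [map_mul, map_inv, ofFinite_ofLocalFinite]; rfl
    have hmem : u * (ofLocalFinite K v (toLocalFinite K v u))⁻¹ ∈ U := U.mul_mem hu.1 (U.inv_mem (hKU ⟨_, huv, rfl⟩))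
    have h1 : GLn.toLocalAt 2 K v (GLn.ofFinite 2 K (u * (ofLocalFinite K v (toLocalFinite K v u))⁻¹)) = 1 := by
      rw [← e]; exact hs1
    rw [e]
    exact hθU _ hmem h1 h
  have e : GLn.ofFinite 2 K u * g =
      (s * (GLn.toAdelic 2 K v (toLocalFinite K v u) * @id (AdelicGroupData.gl 2 K).Adelic g) : (AdelicGroupData.gl 2 K).Adelic) := by
    rw [← mul_assoc, ← ofFinite_eq_awayFrom_mul_toAdelic (v := v) u]; rfl
  rw [e, D.shellConv_mul_of_toLocalAt_eq_one θ hs1 hθs, D.shellConv_toAdelic_mul hθc hθK (D.localCongruenceSubgroup_le_J hN' huv),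
    D.shellChar_eq_one_of_mem_localCongruenceSubgroup hN' huv, map_one, one_mul]
  rfl

/-- Auxiliary. [folklore] -/
theorem shellRe_ofFinite_mul {N' : ℕ} (hN' : D.LevelOK N') (hKU : (localCongruenceSubgroup 2 K v N').map (ofLocalFinite K v) ≤ U)
    {θ : (AdelicGroupData.gl 2 K).Adelic → ℝ} (hθc : Continuous θ) (hθK : D.IsLeftKvInvariant θ)
    (hθU : ∀ u ∈ U, GLn.toLocalAt 2 K v (GLn.ofFinite 2 K u) = 1 → ∀ g : GL (Fin 2) (AdeleRing (𝓞 K) K), θ (GLn.ofFinite 2 K u * g) = θ g) :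
    ∀ u ∈ levelInfAt K v U N', ∀ g : GL (Fin 2) (AdeleRing (𝓞 K) K), D.shellRe θ (GLn.ofFinite 2 K u * g) = D.shellRe θ g :=
  fun _ hu g => by rw [shellRe, shellRe, D.shellConv_ofFinite_mul hN' hKU hθc hθK hθU hu g]

/-- Auxiliary. [folklore] -/
theorem shellIm_ofFinite_mul {N' : ℕ} (hN' : D.LevelOK N') (hKU : (localCongruenceSubgroup 2 K v N').map (ofLocalFinite K v) ≤ U)
    {θ : (AdelicGroupData.gl 2 K).Adelic → ℝ} (hθc : Continuous θ) (hθK : D.IsLeftKvInvariant θ)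
    (hθU : ∀ u ∈ U, GLn.toLocalAt 2 K v (GLn.ofFinite 2 K u) = 1 → ∀ g : GL (Fin 2) (AdeleRing (𝓞 K) K), θ (GLn.ofFinite 2 K u * g) = θ g) :
    ∀ u ∈ levelInfAt K v U N', ∀ g : GL (Fin 2) (AdeleRing (𝓞 K) K), D.shellIm θ (GLn.ofFinite 2 K u * g) = D.shellIm θ g :=
  fun _ hu g => by rw [shellIm, shellIm, D.shellConv_ofFinite_mul hN' hKU hθc hθK hθU hu g]

end Integral

/-! ### Archimedean word derivatives commute with the shell convolution -/

section Deriv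

variable [MeasurableSpace (GL (Fin 2) (v.adicCompletion K))] [BorelSpace (GL (Fin 2) (v.adicCompletion K))]
  (hcpt : isCompact_glFiniteIntegralLevel 2 K)

omit D [MeasurableSpace (GL (Fin 2) (v.adicCompletion K))] [BorelSpace (GL (Fin 2) (v.adicCompletion K))] in
/-- `ι_v(j)` has trivial archimedean component. [folklore] -/
theorem _root_.Literature.NumberTheory.Automorphic.GLn.toMixed_toAdelic (j : GL (Fin 2) (v.adicCompletion K)) :
    GLn.toMixed 2 K (GLn.toAdelic 2 K v j) = 1 := by
  rw [GLn.toMixed_apply, GLn.toAdelic_apply, ← ofFinite_ofLocalFinite, GLn.fstHom_ofFinite, map_one]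

/-- **`(Re(e_J ⋆ θ))_w = Re(e_J ⋆ θ_w)`.** [folklore] -/
theorem wordDerivWeight_shellRe {θ : (AdelicGroupData.gl 2 K).Adelic → ℝ} (hθ : IsTestFunctionGL 2 K θ) (w : List (AutomorphyDatum.gl 2 K hcpt).arch.lie) :
    wordDerivWeight (AutomorphyDatum.gl 2 K hcpt).ofArch w (D.shellRe θ) = D.shellRe (wordDerivWeight (AutomorphyDatum.gl 2 K hcpt).ofArch w θ) := by
  rw [shellRe_eq_sum, shellRe_eq_sum]
  refine (wordDerivWeight_sum_testFunction hcpt Finset.univ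
    (θ := fun q => (D.coef q).re • leftTranslateWeight (n := 2) (GLn.toAdelic 2 K v (D.rep q)) θ)
    (fun q _ => (hθ.leftTranslate _).const_smul _) w).trans ?_
  refine Finset.sum_congr rfl fun q _ => ?_
  refine (wordDerivWeight_smul_weight hcpt _ (leftTranslateWeight (n := 2) (GLn.toAdelic 2 K v (D.rep q)) θ) w).trans ?_
  rw [wordDerivWeight_leftTranslateWeight_of_toMixed_eq_one hcpt hθ (GLn.toMixed_toAdelic (D.rep q))]

/-- **`(Im(e_J ⋆ θ))_w = Im(e_J ⋆ θ_w)`.** [folklore] -/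
theorem wordDerivWeight_shellIm {θ : (AdelicGroupData.gl 2 K).Adelic → ℝ} (hθ : IsTestFunctionGL 2 K θ) (w : List (AutomorphyDatum.gl 2 K hcpt).arch.lie) :
    wordDerivWeight (AutomorphyDatum.gl 2 K hcpt).ofArch w (D.shellIm θ) = D.shellIm (wordDerivWeight (AutomorphyDatum.gl 2 K hcpt).ofArch w θ) := by
  rw [shellIm_eq_sum, shellIm_eq_sum]
  refine (wordDerivWeight_sum_testFunction hcpt Finset.univ
    (θ := fun q => (D.coef q).im • leftTranslateWeight (n := 2) (GLn.toAdelic 2 K v (D.rep q)) θ)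
    (fun q _ => (hθ.leftTranslate _).const_smul _) w).trans ?_
  refine Finset.sum_congr rfl fun q _ => ?_
  refine (wordDerivWeight_smul_weight hcpt _ (leftTranslateWeight (n := 2) (GLn.toAdelic 2 K v (D.rep q)) θ) w).trans ?_
  rw [wordDerivWeight_leftTranslateWeight_of_toMixed_eq_one hcpt hθ (GLn.toMixed_toAdelic (D.rep q))]

end Deriv

/-! ### Smoothed vectors: the shell convolution acts as the twisted projector -/

section Smoothed

variable [MeasurableSpace (GL (Fin 2) (v.adicCompletion K))] [BorelSpace (GL (Fin 2) (v.adicCompletion K))]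
variable {μ : Measure (AdelicGroupData.gl 2 K).automorphicQuotient} [(AdelicGroupData.gl 2 K).IsAutomorphicMeasure μ]

attribute [local instance] adelicBorel borelSpace_adelic locallyCompactSpace_adelic secondCountableTopology_gl_adelic

variable (W : ContRepresentation.ClosedSubrep ((AdelicGroupData.gl 2 K).rightRegular μ))

omit [MeasurableSpace (GL (Fin 2) (v.adicCompletion K))] [BorelSpace (GL (Fin 2) (v.adicCompletion K))] in
/-- `S_{∑_q a_q L_{ι_v(j_q)} θ} f = ∑_q a_q R(ι_v(j_q)) S_θ f` in `L²`. [folklore] -/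
theorem coe_smoothedVector_sum_smul_leftTranslate {θ : (AdelicGroupData.gl 2 K).Adelic → ℝ} (hθ : IsTestFunctionGL 2 K θ) (a : ↥D.J ⧸ D.KJ → ℝ)
    (f : W.toSubmodule) :
    (smoothedVector W (∑ q, a q • leftTranslateWeight (n := 2) (GLn.toAdelic 2 K v (D.rep q)) θ) f : (AdelicGroupData.gl 2 K).L2 μ) =
      ∑ q, (a q : ℂ) • localRightRegular K v μ (D.rep q) (smoothedVector W θ f : (AdelicGroupData.gl 2 K).L2 μ) := by
  have hc : ∀ q, Continuous (a q • leftTranslateWeight (n := 2) (GLn.toAdelic 2 K v (D.rep q)) θ) := fun q =>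
    (continuous_leftTranslateWeight hθ.continuous _).const_smul _
  have hs : ∀ q, HasCompactSupport (a q • leftTranslateWeight (n := 2) (GLn.toAdelic 2 K v (D.rep q)) θ) := fun q =>
    (hasCompactSupport_leftTranslateWeight hθ.hasCompactSupport _).mono (Function.support_const_smul_subset _ _)
  have h := smoothedVector_finset_sum_weight (W := W) Finset.univ (η := fun q => a q • leftTranslateWeight (n := 2) (GLn.toAdelic 2 K v (D.rep q)) θ) hc hs f
  rw [← Finset.sum_fn] at h
  rw [h, Submodule.coe_sum]
  refine Finset.sum_congr rfl fun q _ => ?_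
  rw [smoothedVector_smul_weight, Submodule.coe_smul, coe_smoothedVector_leftTranslate W hθ.continuous hθ.hasCompactSupport, localRightRegular_apply]

omit [MeasurableSpace (GL (Fin 2) (v.adicCompletion K))] [BorelSpace (GL (Fin 2) (v.adicCompletion K))] in
/-- The level invariance of `S_θ f` at `v`: `R(ι_v(k)) S_θ f = S_θ f` for `k ∈ K_v(e^{-N})` when `θ` is left
`ι_v(K_v(e^{-N}))`-invariant. [folklore] -/
theorem localRightRegular_smoothedVector_of_mem_Kv' {θ : (AdelicGroupData.gl 2 K).Adelic → ℝ} (hθ : IsTestFunctionGL 2 K θ)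
    (hθK : D.IsLeftKvInvariant θ) (f : W.toSubmodule) {k : GL (Fin 2) (v.adicCompletion K)} (hk : k ∈ D.Kv) :
    localRightRegular K v μ k (smoothedVector W θ f : (AdelicGroupData.gl 2 K).L2 μ) = smoothedVector W θ f := by
  have e : leftTranslateWeight (n := 2) (GLn.toAdelic 2 K v k) θ = θ := by
    funext h
    rw [leftTranslateWeight_apply, ← map_inv, hθK _ (D.Kv.inv_mem hk)]
  rw [localRightRegular_apply, ← coe_smoothedVector_leftTranslate W hθ.continuous hθ.hasCompactSupport, e]

/-- **The shell convolution acts on smoothed vectors as the twisted projector**: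
`S_{Re(e_J⋆θ)} f + i S_{Im(e_J⋆θ)} f = E (S_θ f)`. [cite: Bump1997, §4.4] -/
theorem coe_smoothedVector_shellRe_add_shellIm {θ : (AdelicGroupData.gl 2 K).Adelic → ℝ} (hθ : IsTestFunctionGL 2 K θ)
    (hθK : D.IsLeftKvInvariant θ) (f : W.toSubmodule) :
    (smoothedVector W (D.shellRe θ) f : (AdelicGroupData.gl 2 K).L2 μ) + Complex.I • (smoothedVector W (D.shellIm θ) f : (AdelicGroupData.gl 2 K).L2 μ) =
      twistedAverage D.J D.isCompact_J (localRightRegular K v μ) (shellChar K v) (smoothedVector W θ f : (AdelicGroupData.gl 2 K).L2 μ) := by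
  set w : (AdelicGroupData.gl 2 K).L2 μ := (smoothedVector W θ f : (AdelicGroupData.gl 2 K).L2 μ) with hw
  -- left side: `∑_q c_q • R(j_q) w`
  have hL : (smoothedVector W (D.shellRe θ) f : (AdelicGroupData.gl 2 K).L2 μ) + Complex.I • (smoothedVector W (D.shellIm θ) f : (AdelicGroupData.gl 2 K).L2 μ) =
      ∑ q, D.coef q • localRightRegular K v μ (D.rep q) w := by
    rw [shellRe_eq_sum, shellIm_eq_sum, D.coe_smoothedVector_sum_smul_leftTranslate W hθ, D.coe_smoothedVector_sum_smul_leftTranslate W hθ,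
      Finset.smul_sum, ← Finset.sum_add_distrib]
    refine Finset.sum_congr rfl fun q _ => ?_
    rw [smul_smul, ← add_smul]
    congr 1
    rw [mul_comm]
    exact Complex.re_add_im _
  -- right side: the coset sum of the twisted average
  have hT := isTwistData_shell K v μ D.hc D.hψ
  have hF : ∀ j : ↥D.J, ∀ k ∈ D.KJ, conj (shellChar K v ((j * k : ↥D.J) : GL (Fin 2) (v.adicCompletion K))) •
      localRightRegular K v μ ((j * k : ↥D.J) : GL (Fin 2) (v.adicCompletion K)) w =
      conj (shellChar K v (j : GL (Fin 2) (v.adicCompletion K))) • localRightRegular K v μ (j : GL (Fin 2) (v.adicCompletion K)) w := by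
    intro j k hk
    have hk' : (k : GL (Fin 2) (v.adicCompletion K)) ∈ D.Kv := D.mem_KJ_iff.1 hk
    rw [Subgroup.coe_mul, shellChar_mul D.hψ j.2 (D.Kv_le_J hk'), D.shellChar_eq_one_of_mem_Kv hk', mul_one,
      hT.rep_mul_apply, hw, D.localRightRegular_smoothedVector_of_mem_Kv' W hθ hθK f hk']
  have hsum := integral_eq_sum_quotient_of_mul_invariant (subgroupHaar D.J D.isCompact_J) D.KJ D.isOpen_KJ
    (hT.integrable_integrand (hJ := D.isCompact_J) w) hF
  rw [hL, twistedAverage_def]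
  refine Eq.trans ?_ hsum.symm
  refine Finset.sum_congr rfl fun q _ => ?_
  rw [coef, mass, rep, mul_smul]
  exact (RCLike.real_smul_eq_coe_smul (K := ℂ) _ _).symm

end Smoothed

end ShellDatum

end Literature.NumberTheory.Automorphic
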